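import Mathlib
import HarnessLib
import HarnessLib.Audit
import Summits.ABC.ABC.Statement

/-!
Route: RadicalCensus

CLOSED (retired) 2026-08-15T16:14:53Z by planner-rbadge-ABC-RadicalCensus-b0ea5fe5-g4-0 — reason: not-a-thesis: no deciding theorem exists over the listed items in either polarity — every item (W1 = RadicalDensityZero, SubexpHeightAlmostAll, TripleCountByRadical, FewPrimeRadicalsPowerSaving, PolyHeightCensus) is a consequence of ABC and — note: route-repair planner b0ea5fe5-g4 (glue stamp, D-0027 §2.1). CENSUS: tried (i) closes over listed items → impossible either polarity (items → ¬ABC would prove ¬ABC outright; density statements ↛ ABC); (ii) refutation re-frame with item ¬W1 → rejected: W1/¬W1 vacuity, and {TripleCountByRadical, ¬W1} r. The file is kept as the record of this route; refuted decls are indexed as negative knowledge (`ledger negatives`).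

ROUTE TYPE: milestone + kill link (negative side), realising idea card
ABC/ABC/radical-census-density-zero ('the radical census'). X = W1 := abc-radicals have natural
density zero: for every ε > 0 and all large X, #{R ≤ X : R = rad(abc) for some abc triple (a,b,c)} ≤
εX. Lean (elaborates, Sketch.lean rc 0): ∀ ε : ℝ, 0 < ε → ∀ᶠ X : ℕ in Filter.atTop, (({R : ℕ | R ≤ X
∧ ∃ a b c : ℕ, IsABCTriple a b c ∧ rad a b c = R}.ncard : ℕ) : ℝ) ≤ ε * X (IsABCTriple, rad from
Literature.NumberTheory.DiophantineGeometry.AbcWave0; ABC = the summit constant). W1 is the cheapest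
GLOBAL consequence of ABC (ABC → W1 by an elementary Rankin count, PolyHeightCensus), so the route's
arrow to the summit is the kill link Assembly := ¬W1 → ¬ABC, provable now; it is NOT claimed that W1
→ ABC. Each ranked crux C is likewise a consequence of ABC (¬C → ¬ABC) and either sufficient for W1
(rank 2: sub-exponential height for almost all radicals; rank 3: o(X) abc triples of radical ≤ X =
o(X) full-2-torsion elliptic curves of conductor ≤ X) or its first open toy rung (rank 4: power
saving for radicals with ω ≤ 4). Two-layer plan: these crux statements first; glue (C₂ → W1, C₃ →
W1, Pasten-reduction of C₂) filed as support once a crux is staffed.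

Rationale: WHY THIS LINE. ABC has no negative knowledge on the ledger (0 refuted statements) and no Theorems
file; this route supplies the cheapest global necessary condition of ABC as a refutation target with
a PROVABLE kill link, plus two provable items (PolyHeightCensus, Assembly) that land real theorems,
and records an honest census of what 'most squarefree numbers are not abc-radicals' needs. Imported
areas: counting integers by radical (Rankin; BernertEtAl2024 Prop 1.1, in-tree as
ABCHitCountUpperBound_holds), sub-exponential abc (Pasten2024 Thm 1.4, in-tree named fact), S-unit
solution counts (EvertseGyory2015 Ch. 6, ErdosStewartTijdeman1988), and arithmetic statistics of
elliptic curves by conductor (DukeKowalski2000, BrumerSilverman1996, ShankarShankarWang2021) via the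
Frey dictionary printed in VonkanelMatschke2023 §3.
HONEST CENSUS (corrects the card, agreeing with its triage). (i) Triples with c ≤ R^B contribute ≤
X^{2/3+ε} radicals for every fixed B (PolyHeightCensus) — no δ-saving is needed there, so the card's
engine E1 (determinant method) is moot. (ii) For R with ω(R) ≤ 2log₂log X (all but o(X) of them)
counting by fibres #{u ≤ Y : rad u = r} ≤ (2 log Y)^{ω(r)} stays X^{o(1)} up to log c ≤ X^{c/loglog
X}; beyond that, fibres at Stewart–Yu height exp(R^{1/3}) are X^{(loglog X)/3}, superpolynomial, so
'scales × per-scale bound' (card) cannot work and a δ off the exponent 1/3 (engine E2) does not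
help. (iii) Pasten2024 Thm 1.4(2): log c ≤ q·exp(κ√(log R loglog R)), q = min(P(a),P(b),P(c)), puts
every triple with q ≤ exp((log R)^{0.55}) inside the countable range. RESIDUAL ENEMY: for a
density-one set of R, triples whose three members each carry a prime > exp((log R)^{0.55}) and with
log c > exp((log R)^θ) — balanced (a > c^{1−η}, Pasten Thm 1.4(1)), quality → ∞. Everything filed is
aimed at that enemy.
RANKED CRUXES. rank 2 SubexpHeightAlmostAll (height side: sub-exponential abc for almost all
radicals; W1 follows by counting (ii)). rank 3 TripleCountByRadical (counting side: N'(X) =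
#{triples, rad ≤ X} = o(X) ⟺ o(X) elliptic curves with full rational 2-torsion by conductor, against
Duke–Kowalski X^{1+ε}; implies W1 at once). rank 4 FewPrimeRadicalsPowerSaving (toy ladder: ω(R) ≤ 3
is settled by Pasten + counting since q ≤ 2 there; ω = 4 is the first rung with the enemy
configuration 2^k p^l ± q^m ± r^n = 0, min(p,q,r) large). Support: PolyHeightCensus (provable now).
Assembly: ¬W1 → ¬ABC (provable now from PolyHeightCensus, B = 2).
KILL / CLOSE CRITERIA. Any item refuted ⟹ ABC refuted (each item is a consequence of ABC) — route
and summit close negatively. W1 proved (via rank 2 or 3 or directly) ⟹ milestone reached: close the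
route 'superseded/exhausted' keeping the theorems; it does not bear on ABC further. Data check first
(refuter): tabulate #{abc-radicals ≤ X} and N'(X) for X ≤ 10^7 from VonkanelMatschke2023 D1; an
exponent visibly above 2/3 + o(1) would falsify the census heuristics (not W1) and should be
recorded on the target.
NOT DECOMPOSED YET (glue later, D-0019): G1 SubexpHeightAlmostAll → W1 (divisor-sum bound for ω,
fibre count); G2 TripleCountByRadical → W1 (one line); G3 pasten2024_thm_1_4_2 → ('large-q triples
are sparse' → SubexpHeightAlmostAll); the √X lower bound and the X^{2/3} heuristic; any certified
computation. No extra imports: all statements live over AbcWave0 (IsABCTriple, rad) + Mathlib, so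
the route adds no named-fact debt to its cone.

Novelty: Searched 2026-08-15: lit search --hybrid (local), zbMATH (OpenAlex/S2/arXiv rate-limited), lit
frontier/bridges ABC, lit galaxy search --star all ('abc triples with bounded radical' 0 hits;
'radical of abc' 7 generic hits). Nearest prior art FOUND: (1) counting WITH BOUNDED HEIGHT —
Kane2015 (arXiv:1104.2635: |A|,|B|,|C| ≤ N, radical constraints), BernertEtAl2024 (N_λ(X) ≪
X^{33/50}), Dahmen2008; in-tree ABCHitCountUpperBound_holds. (2) heights pointwise in R —
StewartYu2001, Pasten2024 Thm 1.4. (3) solution counts pointwise in S — Evertse (EvertseGyory2015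
Ch. 6), ErdosStewartTijdeman1988 (supports with many solutions), VonkanelMatschke2023 (all solutions
for every support with N_S ≤ 10^7; Frey/2-torsion dictionary §3). (4) curves by conductor —
DukeKowalski2000 (X^{1+ε}), BrumerSilverman1996, ShankarShankarWang2021 (arXiv:1904.13063, bounded
Szpiro ratio only), FouvryNairTenenbaum1992 (Szpiro off an exceptional set, by naive height). No
source found states W1, N'(X) = o(X), or any 'abc for almost all RADICALS' statement. DELTA: order
abc triples by RADICAL with unbounded height; isolate W1 as the weakest global consequence of ABC
with a provable kill link; show by an honest census (Rankin fibres + Pasten's q-bound) that the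
residue is exactly the balanced triples all of whose members carry a large prime, on a density-one
set of radicals; identify N'(X) = o(X) with a saving over Duke–Kowalski for full-2-torsion curves by
conductor. Claimed grade: new-combination.  [refs: 1104.2635, 1904.13063, Kane2015, BernertEtAl2024, Dahmen2008, StewartYu2001, Pasten2024, EvertseGyory2015, ErdosStewartTijdeman1988, VonkanelMatschke2023, DukeKowalski2000, BrumerSilverman1996, ShankarShankarWang2021, FouvryNairTenenbaum1992]

Barriers (technique_class: radical-census, averaged-subexp-abc, conductor-census): technique_class: radical-census, averaged-subexp-abc, conductor-census
- Literature.Barriers.ABC.BakerMethodBounds: ENGAGED by rank 2. The barrier is the pointwise output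
shape log c ≤ κR^θ(log R)^m of logarithmic forms (state of the art θ = 1/3; Pasten's hybrid
q·exp(κ√(log R loglog R)) listed under evasions (c)). Rank 2 asks for a sub-exponential bound only
off a density-zero set of radicals, which the barrier's letter does not cover (scope caveat (a): no
impossibility theorem, only 'new ideas will be needed'); honest bet: it does NOT evade the mechanism
— the factor q = p lost at each p-adic place is exactly what must be averaged away, and no averaged
Yu/Pasten estimate exists. Ranks 3–4 are counting statements outside the class.
- Literature.Barriers.ABC.EpsilonCannotBeDropped: not engaged — W1 and all cruxes are ε-free
consequences of ABC with any fixed ε (we use ε = 1); the Stewart–Tijdeman/Bright families produce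
X^{o(1)} radicals ≤ X.
- Literature.Barriers.ABC.ExplicitABCQualityFloor: not engaged — no constant-1 or explicit-exponent
claim; Reyssat-type triples are single radicals, invisible to density.
- Literature.Barriers.ABC.NConjectureExponentSharpNarrow, Literature.Barriers.ABC.IUTDisputedClaim:
not engaged (three terms; nothing imported from IUT).
- Negatives index (ledger negatives --problem ABC): 0 refuted statements on 2026-08-15; no item
restates a refuted Prop.

Novelty grade: new-combination — ROUTE REVIEW (refuter 3bae3c4d, 2026-08-15; third reviewer). All 6 decls rc0; statements precise (ncard over subsets of {R ≤ X}; rad in ℕ ≥ 2; rpow bases positive). Grade new-combination as claimed (counting-by-radical × Pasten q-hybrid × Frey/2-torsion conductor census; W1 found in no source by 3 s (refuter refuter-rreview-route-ABC-RadicalCensus--3bae3c4d-0, 2026-08-15T13:46:33Z; prior: Kane2015 arXiv:1104.2635; BernertEtAl2024 Prop 1.1; Dahmen2008 (counting by radical with bounded height; in tree ABCHitCountUpperBound_holds), Pasten2024 Thm 1.4(2); StewartYu2001 (pointwise heights in R), EvertseGyory2015 Ch.6; ErdosStewartTijdeman1988 (solution counts per support), DukeKowalski2000; ShankarShankarWang2021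 arXiv:1904.13063 (curves by conductor), van der Corput 1939 (3-APs of prim)

History (route lifecycle, newest last):
- 2026-08-15T16:14:53Z · CLOSED retired — not-a-thesis: no deciding theorem exists over the listed items in either polarity — every item (W1 = RadicalDensityZero, SubexpHeightAlmostAll, TripleCountByRadical, FewPrimeRadicalsPowerSaving, PolyH (planner-rbadge-ABC-RadicalCensus-b0ea5fe5-g4-0)

sub-problem: ABC · status: closed(retired) · opened planner-plancard-ABC-ABC-radical-census-densi-7d9e73a0-0 2026-08-15T11:01:21Z · rev 1 · ledger route-ABC-RadicalCensus
GENERATED by the gate from the ledger (D-0016/17). Provers cite these decls: `theorem foo : Summit.ABC.ABC.Theses.RadicalCensus.<Decl> := …` in Summits/ABC/ABC/Theorems/<Name>.lean.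
-/

namespace Summit.ABC.ABC.Theses.RadicalCensus

open scoped BigOperators Topology Manifold Classical MeasureTheory ProbabilityTheory Matrix InnerProductSpace ComplexConjugate ContinuousMap
open Filter Set Function TopologicalSpace MeasureTheory

attribute [summit_statement] _root_.ABC

open Literature.Abc

/-- item stmt-ABC-2151 · target · rank 0 · closed · moot by None · by planner
why it might fail: False only if ABC fails on a positive-upper-density set of radicals. As a proof target: BY HEIGHT 'abc almost always' is elementary (Lichtman2025); BY RADICAL one must exclude triples of unbounded height for typical R — counting dies past log c ≈ X^{c/loglog X}, heights known only to R^{1/3+o(1)}.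
sources: StewartYu2001, RobertStewartTenenbaum2014, VonkanelMatschke2023, BernertEtAl2024, Lichtman2025
[target] W1 (milestone; idea card radical-census-density-zero): abc-radicals have natural density
zero — for every ε>0 and all large X, #{R ≤ X : R = rad(abc) for some abc triple} ≤ εX. A
CONSEQUENCE of ABC (ABC → W1 through PolyHeightCensus with B = 2), so its refutation refutes ABC
(Assembly); a proof is a milestone ('most squarefree numbers are never the radical of a coprime a +
b = c') and does not advance ABC. Ambient set: even squarefree numbers (2 ∣ abc always), density
2/π²; expected truth #{abc-radicals ≤ X} = X^{2/3+o(1)} (≥ c√X from the triples (1, m, m+1) with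
m(m+1) squarefree; polynomial-height triples give X^{2/3+o(1)}). Exact data for X ≤ 10^7:
VonkanelMatschke2023 database D1 lists Σ(N) = all solutions for all supports with N_S ≤ N, for every
N ≤ 10^7 — a refuter can tabulate #{abc-radicals ≤ X} and the exponent. Honest census (replaces the
card's '1/3 + 2/3 = 1' calibration, shown by its triage to be numerology): everything of height c ≤
R^B is already ≤ X^{2/3+ε}; the WHOLE difficulty is triples of quality > B (super-polynomial height)
on a density-one set of radicals — see the cruxes and the rationale. -/
@[route_item "route-ABC-RadicalCensus"]
def RadicalDensityZero : Prop :=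
  ∀ ε : ℝ, 0 < ε → ∀ᶠ X : ℕ in Filter.atTop, (({R : ℕ | R ≤ X ∧ ∃ a b c : ℕ, Literature.NumberTheory.DiophantineGeometry.IsABCTriple a b c ∧ Literature.NumberTheory.DiophantineGeometry.rad a b c = R}.ncard : ℕ) : ℝ) ≤ ε * (X : ℝ)

/-- item stmt-ABC-2152 · crux · rank 2 · closed · moot by None · by planner
why it might fail: Needs the factor q = min P(·) removed from Pasten's bound on average over R: p-adic log-forms lose the prime p at each place (BakerMethodBounds 'because'; Győry 2008: log c ≪_t Q(log Q)^t), no averaged-over-radicals Yu/Pasten estimate exists, density one in R gives no handle on the prime partition.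
sources: Pasten2024, StewartYu2001, Gyory2008, EvertseGyory2015, BakerWustholz2007, Literature.Barriers.ABC.pasten2024_thm_1_4_2
[crux, rank 2 — height side: 'sub-exponential abc for almost all radicals'] For some θ<1, the
radicals R carrying an abc triple with log c > exp((log R)^θ) have density zero; equivalently, off a
density-zero set of R EVERY triple with rad(abc) = R has log c ≤ exp((log R)^θ). Implies the target
by elementary counting (glue G1, to be filed: R with ω(R) > 2log₂log X are o(X) since Σ_{n≤X}
2^{ω(n)} ≤ Σ d(n) ≤ X(1+log X); for the others a triple of height log c ≤ exp((log X)^θ) is fixed by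
its two smallest-radical members u, v, rad u·rad v ≤ X^{2/3}, and #{u ≤ Y : rad u = r} ≤ (2 log
Y)^{ω(r)} = X^{o(1)}). ABC → this crux. Pointwise state of the art: log c ≪ R^{1/3}(log R)^3
(StewartYu2001 = Literature.Barriers.ABC.BakerMethodBounds); log c ≤ q·exp(κ√(log R·loglog R)) with
q = min(P(a),P(b),P(c)) (Pasten2024 Thm 1.4(2) = Literature.Barriers.ABC.pasten2024_thm_1_4_2,
in-tree conditional on evertseGyory_thm_4_2_1_rat, pasten2024_thm_2_5). So the crux is settled for
triples with q ≤ exp((log R)^{0.55}) (e.g. whenever ω(R) ≤ 3); what remains: for a density-one set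
of R, no triple whose three members EACH carry a prime > exp((log R)^{0.55}) has log c > exp((log
R)^θ). -/
@[route_item "route-ABC-RadicalCensus"]
def SubexpHeightAlmostAll : Prop :=
  ∃ θ : ℝ, 0 < θ ∧ θ < 1 ∧ ∀ ε : ℝ, 0 < ε → ∀ᶠ X : ℕ in Filter.atTop, (({R : ℕ | R ≤ X ∧ ∃ a b c : ℕ, Literature.NumberTheory.DiophantineGeometry.IsABCTriple a b c ∧ Literature.NumberTheory.DiophantineGeometry.rad a b c = R ∧ Real.exp ((Real.log (R : ℝ)) ^ θ) < Real.log (c : ℝ)}.ncard : ℕ) : ℝ) ≤ ε * (X : ℝ)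

/-- item stmt-ABC-2153 · crux · rank 3 · closed · moot by None · by planner
why it might fail: S-unit solution counts are exp(O(s)) pointwise (even N'(X) = O(X) is open), large for special supports (EST 1988: ≥ exp(c√(s/log s))); o(X) needs MOST supports solution-free — no precedent. By conductor: Duke–Kowalski X^{1+ε} only; asymptotics need bounded Szpiro ratio (SSW2021, Xiao2024).
sources: DukeKowalski2000, ShankarShankarWang2021, arXiv:2303.16476, BrumerSilverman1996, EvertseGyory2015, ErdosStewartTijdeman1988
[crux, rank 3 — counting side = conductor census] N'(X) := #{abc triples with rad(abc) ≤ X} = o(X),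
finiteness built in (a set of ≤ εX triples contains every triple of radical ≤ X). Implies the target
(glue G2). Trivially N'(X) ≪ X(log X)^{O(1)} (Evertse's exp(O(s)) solution bound, EvertseGyory2015
Ch. 6); expected X^{2/3+o(1)}. DICTIONARY (Frey–Hellegouarch; printed in VonkanelMatschke2023 §3):
(a,b,c) ↦ E: y² = x(x−a)(x+b), full rational 2-torsion, conductor 2^e·∏_{odd p∣abc} p (e ≤ 8), Δ_min
= 2^{e'}(abc)²; conversely every E/ℚ with E(ℚ)[2] = (ℤ/2)² and conductor N comes from an S-unit
solution, S = primes of 2N. So, up to bounded factors and quadratic twists, N'(X) IS the count of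
full-2-torsion elliptic curves over ℚ by conductor ≤ X, and the crux asks for o(X) there. Known:
O(X^{1+ε}) for all curves (DukeKowalski2000, quoted in ShankarShankarWang2021 §1; pointwise
BrumerSilverman1996 ≪ N^{1/2+ε}); ShankarShankarWang2021 get asymptotics only for Δ < C^κ, κ < 7/4
(bounded Szpiro ratio = our polynomial-height regime) and name 'large discriminant, small conductor'
as the open difficulty = the high-quality triples here. Data X ≤ 10^7: VonkanelMatschke2023 D1. ABC
→ this crux. -/
@[route_item "route-ABC-RadicalCensus"]
def TripleCountByRadical : Prop :=
  ∀ ε : ℝ, 0 < ε → ∀ᶠ X : ℕ in Filter.atTop, ∃ T : Finset (ℕ × ℕ × ℕ), (T.card : ℝ) ≤ ε * (X : ℝ) ∧ ∀ a b c : ℕ, Literature.NumberTheory.DiophantineGeometry.IsABCTriple a b c → Literature.NumberTheory.DiophantineGeometry.rad a b c ≤ X → (a, b, c) ∈ T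

/-- item stmt-ABC-2154 · crux · rank 4 · closed · moot by None · by planner
why it might fail: Hard case 2^k p^l ± q^m ± r^n = 0 with min(p,q,r) > exp((log X)^0.55) and huge exponents is a Pillai/generalized-Fermat family with VARYING prime bases: per-(p,q,r) finiteness is S-unit theory / Darmon–Granville (exponential or ineffective), and nothing counts the bases admitting a huge solution.
sources: Pasten2024, StewartYu2001, DarmonGranville1995, EvertseGyory2015, ShoreyTijdeman1986
[crux, rank 4 — first open rung of the toy ladder in ω(R)] A power saving for abc-radicals with at
most four prime factors: #{R ≤ X : ω(R) ≤ 4, R = rad(abc) for some triple} ≪ X^{1−δ} (≍ X(loglog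
X)³/log X candidates). Not implied by the target (such R have density 0 anyway) but implied by ABC
(≪ X^{2/3+ε}). Lower rungs: R = 2p is an abc-radical iff p^l = 2^k ± 1 (O(log X) radicals); for ω(R)
= 3 every triple has a member 1 or 2^k, so q = min P(·) ≤ 2 and Pasten2024 Thm 1.4(2) caps log c ≤
2exp(κ√(log R·loglog R)); fibre counting then gives ≪ X^{2/3+o(1)} (conditional in-tree on
evertseGyory_thm_4_2_1_rat, pasten2024_thm_2_5). ω(R) = 4 is the first rung with a configuration
outside every known height bound: R = 2pqr, min(p,q,r) > exp((log X)^{0.55}) (a positive proportion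
of such R), partition 2^k·p^l ± q^m ± r^n = 0 — three prime powers, huge exponents, VARYING prime
bases. Crux = for all but O(X^{1−δ}) triples (p,q,r) there is no solution with log c > exp((log
X)^{0.55}) (smaller ones are counted directly). Levers special to this rung: Frey curve y² =
x(x−r^n)(x+q^m) of conductor 2^e·pqr with three huge exponents (level-lowering at ℓ ∣ n strips r);
large sieve over (p,q,r). -/
@[route_item "route-ABC-RadicalCensus"]
def FewPrimeRadicalsPowerSaving : Prop :=
  ∃ δ : ℝ, 0 < δ ∧ ∃ C : ℝ, ∀ X : ℕ, 2 ≤ X → (({R : ℕ | R ≤ X ∧ R.primeFactors.card ≤ 4 ∧ ∃ a b c : ℕ, Literature.NumberTheory.DiophantineGeometry.IsABCTriple a b c ∧ Literature.NumberTheory.DiophantineGeometry.rad a b c = R}.ncard : ℕ) : ℝ) ≤ C * (X : ℝ) ^ (1 - δ)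

/-- item stmt-ABC-2155 · support · rank 9 · closed · moot by None · by planner
why it might fail: It should not fail: routine extension of the proved ABCHitCountUpperBound_holds; only the B-dependence of δ = ε/(2B+2) and the passage from triples to radicals (ncard of an image) need care.
sources: BernertEtAl2024, Dahmen2008, Lichtman2025
[support — provable now; needed by the Assembly (B = 2) and by glue G1] Polynomial-height census:
for B ∈ ℕ and K, ε > 0 there is C with #{R ≤ X : some abc triple has rad(abc) = R and c ≤ K·R^B} ≤
C·X^{2/3+ε} for X ≥ 2. Proof = the library's Rankin argument for ABCHitCountUpperBound_holds
(Literature/NumberTheory/DiophantineGeometry/AbcHitCountUpperBoundProofs.lean) with Y = K·X^B in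
place of X in the fibres: pairwise coprimality gives rad a·rad b·rad c = R ≤ X, so the two smallest
radicals r, s satisfy (rs)³ ≤ X²; the triple is determined by those two members u, v ≤ Y;
AbcHits.card_radFibre_le bounds #{u ≤ Y : rad u = r} ≤ K_δ Y^δ r^δ; AbcHits.card_hyperbolaPairs_le
counts (r,s); total ≤ 3K_δ²K^{2δ}(1+log X)·X^{2/3+(2B+1)δ}, take δ = ε/(2B+2); finally #radicals ≤
#triples (image of a finite set). This is BernertEtAl2024 Prop. 1.1 ('trivial bound' N_λ ≪
X^{2λ/3+ε}) read at λ = 1/B and counting radicals. -/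
@[route_item "route-ABC-RadicalCensus"]
def PolyHeightCensus : Prop :=
  ∀ B : ℕ, ∀ K ε : ℝ, 0 < ε → ∃ C : ℝ, ∀ X : ℕ, 2 ≤ X → (({R : ℕ | R ≤ X ∧ ∃ a b c : ℕ, Literature.NumberTheory.DiophantineGeometry.IsABCTriple a b c ∧ Literature.NumberTheory.DiophantineGeometry.rad a b c = R ∧ (c : ℝ) ≤ K * (R : ℝ) ^ B}.ncard : ℕ) : ℝ) ≤ C * (X : ℝ) ^ (2 / 3 + ε : ℝ)

/-- item stmt-ABC-2156 · assembly · rank 1 · closed · moot by None · by planner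
why it might fail: Provable outright from PolyHeightCensus (B = 2); no risk beyond formalisation.
sources: BombieriGubler2006, BernertEtAl2024
[assembly — the kill link, provable now] ¬W1 → ¬ABC, i.e. ABC → (abc-radicals have density zero):
under ABC with ε = 1 there is C with c < C·rad(abc)² for every triple, so every abc-radical R ≤ X is
counted by PolyHeightCensus (B = 2, K = C): #{abc-radicals ≤ X} ≤ C'·X^{3/4} ≤ εX for X large. The
hypothesis is literally ¬RadicalDensityZero (Iff.rfl in Sketch.lean). This is the arrow to the
summit of this MILESTONE route (negative side; D-0019 frame item #1 with Statement := ¬ABC): a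
refutation of the target — or of any crux, each being itself a consequence of ABC — closes ABC
negatively; proofs of the target/cruxes are milestones and are not claimed to advance ABC. -/
@[route_item "route-ABC-RadicalCensus"]
def Assembly : Prop :=
  ¬ (∀ ε : ℝ, 0 < ε → ∀ᶠ X : ℕ in Filter.atTop, (({R : ℕ | R ≤ X ∧ ∃ a b c : ℕ, Literature.NumberTheory.DiophantineGeometry.IsABCTriple a b c ∧ Literature.NumberTheory.DiophantineGeometry.rad a b c = R}.ncard : ℕ) : ℝ) ≤ ε * (X : ℝ)) → ¬ ABC

end Summit.ABC.ABC.Theses.RadicalCensus
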